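import Summits.PneNP.PneNP.Theorems.KarlinRubinMonotoneBlindDnfWitness

/-!
# Route KarlinRubin, crux `MonotoneBlind` (stmt-PneNP-18027): depth 3 — the encoding lemma for touching sets

Combinatorial core of the depth-3 rescue lemma (seat write-up `MonotoneBlind_depth3_theorem.md`, Step 4). Fix a
family `𝒲` of "white clauses" (finite sets of slots of `Kₙ`), each with at most `L` slots. A vertex set `Z` is
*touching* (`τ Z`) if every clause of `𝒲` has a slot inside `Z` (both endpoints in `Z`); `𝓜` is the family of
*minimal* touching sets (no single vertex can be removed). The predicates are taken as parameters `τ`, `𝓜`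
characterized by `hτ`, `h𝓜` (no definitions are introduced).

* `depth3_touching_mono`, `depth3_exists_minimal_touching` — touching is up-closed; a touching set contains a
  minimal one;
* `depth3_encoding_count` — **the encoding lemma**: the minimal touching sets `Z ⊇ Y` with `#Z ≤ zmax` number at
  most `L^{zmax - #Y}` (if `Y` is not touching, fix ANY clause `S₀` untouched by `Y`; a touching `Z ⊇ Y` contains
  the endpoints of a slot of `S₀`, which adds a vertex to `Y`: at most `L` branches per added vertex); in particular
  `#{Z ∈ 𝓜 : #Z ≤ z} ≤ L^z`;
* `depth3_choose_card_ge_of_disjoint_parts` — if `m'` clauses of `𝒲` have pairwise disjoint inside-`A` parts, every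
  touching `Z ⊆ A` spans `≥ m'` slots: `m' ≤ C(#Z, 2)`;
* `depth3_card_kSubsets_superset_minimal_mul_le` — `#{A ∈ kSubsets : A ⊇ some Z ∈ 𝓜 with #Z = z} · n^z ≤
  L^z · #kSubsets · d^z` (`d = min k n`).

All `--supports stmt-PneNP-18027`; no definitions.
-/

set_option linter.dupNamespace false -- `Summit.PneNP.PneNP.…`: summit = sub-problem (D-0017)

namespace Summit.PneNP.PneNP.Theorems

open Finset
open Literature.Computability.Complexity
open Literature.Probability.RandomGraphs.PlantedClique

variable {n : ℕ}

section Touching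

variable (𝒲 : Finset (Finset (⊤ : SimpleGraph (Fin n)).edgeSet)) (τ : Finset (Fin n) → Prop)
  (hτ : ∀ Z, τ Z ↔ ∀ S ∈ 𝒲, ∃ e ∈ S, ∀ v ∈ (e : Sym2 (Fin n)), v ∈ Z)

include hτ

/-- Touching is up-closed. [folklore] -/
theorem depth3_touching_mono {Z Z' : Finset (Fin n)} (hZ : τ Z) (hZZ' : Z ⊆ Z') : τ Z' := by
  rw [hτ] at hZ ⊢
  intro S hS
  obtain ⟨e, he, heZ⟩ := hZ S hS
  exact ⟨e, he, fun v hv => hZZ' (heZ v hv)⟩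

variable (𝓜 : Finset (Finset (Fin n))) (h𝓜 : ∀ Z, Z ∈ 𝓜 ↔ τ Z ∧ ∀ v ∈ Z, ¬ τ (Z.erase v))

include h𝓜

omit hτ in
/-- **A touching set contains a minimal touching set** (a touching subset of least cardinality). [folklore] -/
theorem depth3_exists_minimal_touching {A : Finset (Fin n)} (hA : τ A) : ∃ Z ∈ 𝓜, Z ⊆ A := by
  classical
  set P := A.powerset.filter fun Z => τ Z with hP
  have hAP : A ∈ P := by rw [hP, mem_filter, mem_powerset]; exact ⟨Subset.rfl, hA⟩
  obtain ⟨Z, hZP, hZmin⟩ := exists_min_image P card ⟨A, hAP⟩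
  rw [hP, mem_filter, mem_powerset] at hZP
  refine ⟨Z, (h𝓜 Z).2 ⟨hZP.2, fun v hv hτv => ?_⟩, hZP.1⟩
  have hmem : Z.erase v ∈ P := by
    rw [hP, mem_filter, mem_powerset]
    exact ⟨(erase_subset v Z).trans hZP.1, hτv⟩
  have := hZmin _ hmem
  rw [card_erase_of_mem hv] at this
  have hpos : 0 < #Z := card_pos.2 ⟨v, hv⟩
  omega

/-- A minimal touching set containing a touching set `Y` is `Y`. [folklore] -/
theorem depth3_minimal_eq_of_touching_subset {Y Z : Finset (Fin n)} (hY : τ Y) (hZ : Z ∈ 𝓜) (hYZ : Y ⊆ Z) :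
    Z = Y := by
  by_contra hne
  have hss : ¬ Z ⊆ Y := fun h => hne (Subset.antisymm h hYZ)
  obtain ⟨v, hvZ, hvY⟩ := not_subset.1 hss
  have hYsub : Y ⊆ Z.erase v := fun w hw => mem_erase.2 ⟨fun h => hvY (h ▸ hw), hYZ hw⟩
  exact ((h𝓜 Z).1 hZ).2 v hvZ (depth3_touching_mono 𝒲 τ hτ hY hYsub)

/-- **The encoding lemma.** If every clause of `𝒲` has at most `L` slots (`1 ≤ L`), then for every `Y` with
`#Y ≤ zmax` the minimal touching sets `Z ⊇ Y` with `#Z ≤ zmax` number at most `L^{zmax - #Y}`. Induction on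
`zmax - #Y`: if `Y` is touching, only `Z = Y` qualifies; otherwise some clause `S₀ ∈ 𝒲` has no slot inside `Y`,
every touching `Z ⊇ Y` contains both endpoints of some slot of `S₀`, and adding them to `Y` increases `#Y`.
[folklore] -/
theorem depth3_encoding_count {L : ℕ} (hL : 1 ≤ L) (hW : ∀ S ∈ 𝒲, #S ≤ L) (zmax : ℕ) :
    ∀ (dd : ℕ) (Y : Finset (Fin n)), zmax - #Y = dd → #Y ≤ zmax →
      #(𝓜.filter fun Z => Y ⊆ Z ∧ #Z ≤ zmax) ≤ L ^ dd := by
  classical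
  intro dd
  induction dd using Nat.strong_induction_on with
  | _ dd ih =>
    intro Y hdd hYz
    by_cases hY : τ Y
    · -- only `Z = Y`
      calc #(𝓜.filter fun Z => Y ⊆ Z ∧ #Z ≤ zmax) ≤ #({Y} : Finset (Finset (Fin n))) := by
            refine card_le_card fun Z hZ => ?_
            rw [mem_filter] at hZ
            rw [mem_singleton]
            exact depth3_minimal_eq_of_touching_subset 𝒲 τ hτ 𝓜 h𝓜 hY hZ.1 hZ.2.1
        _ = 1 := card_singleton _
        _ ≤ L ^ dd := Nat.one_le_pow _ _ hL
    · -- a clause untouched by `Y`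
      have hS₀ : ∃ S₀ ∈ 𝒲, ∀ e ∈ S₀, ¬ ∀ v ∈ (e : Sym2 (Fin n)), v ∈ Y := by
        by_contra h
        refine hY ((hτ Y).2 fun S hS => ?_)
        by_contra h'
        exact h ⟨S, hS, fun e he heY => h' ⟨e, he, heY⟩⟩
      obtain ⟨S₀, hS₀W, hS₀Y⟩ := hS₀
      -- the endpoints of a slot, as a finset
      set V : (⊤ : SimpleGraph (Fin n)).edgeSet → Finset (Fin n) :=
        fun e => univ.filter fun v : Fin n => v ∈ (e : Sym2 (Fin n)) with hV
      have hcover : (𝓜.filter fun Z => Y ⊆ Z ∧ #Z ≤ zmax) ⊆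
          S₀.biUnion fun e => 𝓜.filter fun Z => Y ∪ V e ⊆ Z ∧ #Z ≤ zmax := by
        intro Z hZ
        rw [mem_filter] at hZ
        obtain ⟨hZ𝓜, hYZ, hZz⟩ := hZ
        obtain ⟨e, he, heZ⟩ := (hτ Z).1 ((h𝓜 Z).1 hZ𝓜).1 S₀ hS₀W
        rw [mem_biUnion]
        refine ⟨e, he, mem_filter.2 ⟨hZ𝓜, union_subset hYZ fun v hv => ?_, hZz⟩⟩
        rw [hV, mem_filter] at hv
        exact heZ v hv.2
      -- each branch adds a vertex
      have hgrow : ∀ e ∈ S₀, #Y + 1 ≤ #(Y ∪ V e) := by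
        intro e he
        have hne : ¬ V e ⊆ Y := by
          intro hsub
          refine hS₀Y e he fun v hv => hsub ?_
          rw [hV, mem_filter]
          exact ⟨mem_univ _, hv⟩
        obtain ⟨v, hvV, hvY⟩ := not_subset.1 hne
        calc #Y + 1 = #(insert v Y) := (card_insert_of_notMem hvY).symm
          _ ≤ #(Y ∪ V e) := card_le_card (insert_subset (mem_union_right _ hvV) subset_union_left)
      have hbranch : ∀ e ∈ S₀, #(𝓜.filter fun Z => Y ∪ V e ⊆ Z ∧ #Z ≤ zmax) ≤ L ^ (dd - 1) := by
        intro e he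
        by_cases hfit : #(Y ∪ V e) ≤ zmax
        · have hlt : zmax - #(Y ∪ V e) < dd := by have := hgrow e he; omega
          refine (ih _ hlt (Y ∪ V e) rfl hfit).trans (Nat.pow_le_pow_right hL ?_)
          have := hgrow e he
          omega
        · -- no `Z` fits
          have hempty : (𝓜.filter fun Z => Y ∪ V e ⊆ Z ∧ #Z ≤ zmax) = ∅ := by
            refine filter_eq_empty_iff.2 fun Z _ h => hfit ((card_le_card h.1).trans h.2)
          rw [hempty, card_empty]
          exact Nat.zero_le _
      by_cases hlt : #Y < zmax
      · calc #(𝓜.filter fun Z => Y ⊆ Z ∧ #Z ≤ zmax)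
            ≤ #(S₀.biUnion fun e => 𝓜.filter fun Z => Y ∪ V e ⊆ Z ∧ #Z ≤ zmax) := card_le_card hcover
          _ ≤ ∑ e ∈ S₀, #(𝓜.filter fun Z => Y ∪ V e ⊆ Z ∧ #Z ≤ zmax) := card_biUnion_le
          _ ≤ ∑ _e ∈ S₀, L ^ (dd - 1) := sum_le_sum hbranch
          _ = #S₀ * L ^ (dd - 1) := by rw [sum_const, smul_eq_mul]
          _ ≤ L * L ^ (dd - 1) := Nat.mul_le_mul_right _ (hW S₀ hS₀W)
          _ = L ^ dd := by rw [← pow_succ']; congr 1; omega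
      · -- `#Y = zmax`: every branch is empty
        have hYeq : #Y = zmax := le_antisymm hYz (not_lt.1 hlt)
        calc #(𝓜.filter fun Z => Y ⊆ Z ∧ #Z ≤ zmax)
            ≤ #(S₀.biUnion fun e => 𝓜.filter fun Z => Y ∪ V e ⊆ Z ∧ #Z ≤ zmax) := card_le_card hcover
          _ ≤ ∑ e ∈ S₀, #(𝓜.filter fun Z => Y ∪ V e ⊆ Z ∧ #Z ≤ zmax) := card_biUnion_le
          _ = ∑ e ∈ S₀, 0 := by
              refine sum_congr rfl fun e he => ?_
              have hempty : (𝓜.filter fun Z => Y ∪ V e ⊆ Z ∧ #Z ≤ zmax) = ∅ := by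
                refine filter_eq_empty_iff.2 fun Z _ h => ?_
                have := hgrow e he
                have := (card_le_card h.1).trans h.2
                omega
              rw [hempty, card_empty]
          _ = 0 := sum_const_zero
          _ ≤ L ^ dd := Nat.zero_le _

/-- **Minimal touching sets of size `≤ z` number at most `L^z`.** [folklore] -/
theorem depth3_card_minimal_le_pow {L : ℕ} (hL : 1 ≤ L) (hW : ∀ S ∈ 𝒲, #S ≤ L) (z : ℕ) :
    #(𝓜.filter fun Z => #Z ≤ z) ≤ L ^ z := by
  classical
  have h := depth3_encoding_count 𝒲 τ hτ 𝓜 h𝓜 hL hW z z ∅ (by simp) (by simp)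
  simpa only [empty_subset, true_and, card_empty] using h

omit h𝓜 in
/-- **Disjoint inside parts force large touching sets.** If `m'` clauses of `𝒲` have pairwise disjoint sets of
slots inside `A`, then every touching `Z ⊆ A` has `m' ≤ C(#Z, 2)`: the slots by which `Z` touches them are `m'`
distinct slots inside `Z`. [folklore] -/
theorem depth3_choose_card_ge_of_disjoint_parts {A Z : Finset (Fin n)} (hZA : Z ⊆ A) (hZ : τ Z)
    (𝓕 : Finset (Finset (⊤ : SimpleGraph (Fin n)).edgeSet)) (h𝓕 : 𝓕 ⊆ 𝒲)
    (hdisj : ∀ S ∈ 𝓕, ∀ S' ∈ 𝓕, S ≠ S' →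
      Disjoint (S.filter fun e : (⊤ : SimpleGraph (Fin n)).edgeSet => ∀ v ∈ (e : Sym2 (Fin n)), v ∈ A)
        (S'.filter fun e : (⊤ : SimpleGraph (Fin n)).edgeSet => ∀ v ∈ (e : Sym2 (Fin n)), v ∈ A)) :
    #𝓕 ≤ (#Z).choose 2 := by
  classical
  rw [hτ] at hZ
  -- choose a touching slot for each clause of `𝓕`
  have hc : ∀ S ∈ 𝓕, ∃ e ∈ S, ∀ v ∈ (e : Sym2 (Fin n)), v ∈ Z := fun S hS => hZ S (h𝓕 hS)
  -- degenerate case: no slots at all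
  rcases isEmpty_or_nonempty (⊤ : SimpleGraph (Fin n)).edgeSet with hE | hE
  · have h0 : 𝓕 = ∅ := by
      refine eq_empty_of_forall_notMem fun S hS => ?_
      obtain ⟨e, -, -⟩ := hc S hS
      exact hE.elim e
    rw [h0, card_empty]
    exact Nat.zero_le _
  choose! c hc using hc
  have hinj : Set.InjOn c 𝓕 := by
    intro S hS S' hS' hSS'
    by_contra hne
    have h1 : c S ∈ S.filter fun e : (⊤ : SimpleGraph (Fin n)).edgeSet => ∀ v ∈ (e : Sym2 (Fin n)), v ∈ A :=
      mem_filter.2 ⟨(hc S hS).1, fun v hv => hZA ((hc S hS).2 v hv)⟩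
    have h2 : c S ∈ S'.filter fun e : (⊤ : SimpleGraph (Fin n)).edgeSet => ∀ v ∈ (e : Sym2 (Fin n)), v ∈ A := by
      rw [hSS']
      exact mem_filter.2 ⟨(hc S' hS').1, fun v hv => hZA ((hc S' hS').2 v hv)⟩
    exact Finset.disjoint_left.1 (hdisj S hS S' hS' hne) h1 h2
  calc #𝓕 = #(𝓕.image c) := (card_image_of_injOn hinj).symm
    _ = #((𝓕.image c).filter fun e : (⊤ : SimpleGraph (Fin n)).edgeSet => ∀ v ∈ (e : Sym2 (Fin n)), v ∈ Z) := by
        congr 1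
        refine (filter_true_of_mem fun e he => ?_).symm
        rw [mem_image] at he
        obtain ⟨S, hS, rfl⟩ := he
        exact (hc S hS).2
    _ ≤ (#(Z ∩ univ.filter fun v : Fin n => ∃ e ∈ 𝓕.image c, v ∈ (e : Sym2 (Fin n)))).choose 2 :=
        card_filter_inside_le_choose Z (𝓕.image c)
    _ ≤ (#Z).choose 2 := Nat.choose_le_choose 2 (card_le_card inter_subset_left)

/-- **Planted sets over minimal touching sets.** For every `z`: `#{A ∈ kSubsets : A ⊇ Z for some Z ∈ 𝓜 with #Z = z}
· n^z ≤ L^z · #kSubsets · d^z`, `d = min k n` (union bound over the `≤ L^z` sets `Z`, each inside a random member of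
`kSubsets` with the Kumar–Saraf row count). [folklore] -/
theorem depth3_card_kSubsets_superset_minimal_mul_le {L : ℕ} (hL : 1 ≤ L) (hW : ∀ S ∈ 𝒲, #S ≤ L) (k z : ℕ) :
    #((kSubsets n k).filter fun A => ∃ Z ∈ 𝓜, #Z = z ∧ Z ⊆ A) * n ^ z ≤
      L ^ z * (#(kSubsets n k) * (min k n) ^ z) := by
  classical
  have hcover : ((kSubsets n k).filter fun A => ∃ Z ∈ 𝓜, #Z = z ∧ Z ⊆ A) ⊆
      (𝓜.filter fun Z => #Z = z).biUnion fun Z => (kSubsets n k).filter fun A => Z ⊆ A := by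
    intro A hA
    rw [mem_filter] at hA
    obtain ⟨hAk, Z, hZ, hZz, hZA⟩ := hA
    exact mem_biUnion.2 ⟨Z, mem_filter.2 ⟨hZ, hZz⟩, mem_filter.2 ⟨hAk, hZA⟩⟩
  calc #((kSubsets n k).filter fun A => ∃ Z ∈ 𝓜, #Z = z ∧ Z ⊆ A) * n ^ z
      ≤ #((𝓜.filter fun Z => #Z = z).biUnion fun Z => (kSubsets n k).filter fun A => Z ⊆ A) * n ^ z :=
        Nat.mul_le_mul_right _ (card_le_card hcover)
    _ ≤ (∑ Z ∈ 𝓜.filter (fun Z => #Z = z), #((kSubsets n k).filter fun A => Z ⊆ A)) * n ^ z :=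
        Nat.mul_le_mul_right _ card_biUnion_le
    _ = ∑ Z ∈ 𝓜.filter (fun Z => #Z = z), #((kSubsets n k).filter fun A => Z ⊆ A) * n ^ #Z := by
        rw [sum_mul]
        exact sum_congr rfl fun Z hZ => by rw [(mem_filter.1 hZ).2]
    _ ≤ ∑ Z ∈ 𝓜.filter (fun Z => #Z = z), #(kSubsets n k) * (min k n) ^ #Z :=
        sum_le_sum fun Z _ => card_kSubsets_filter_superset_mul_le Z k
    _ = #(𝓜.filter fun Z => #Z = z) * (#(kSubsets n k) * (min k n) ^ z) := by
        rw [sum_congr rfl fun Z hZ => by rw [(mem_filter.1 hZ).2], sum_const, smul_eq_mul]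
    _ ≤ L ^ z * (#(kSubsets n k) * (min k n) ^ z) := by
        refine Nat.mul_le_mul_right _ ((card_le_card fun Z hZ => ?_).trans
          (depth3_card_minimal_le_pow 𝒲 τ hτ 𝓜 h𝓜 hL hW z))
        rw [mem_filter] at hZ ⊢
        exact ⟨hZ.1, hZ.2.le⟩

end Touching

/-! ### Registered form -/

/-- **stub_depth3Encoding** (registered side result of stmt-PneNP-18027, depth-3 line of seat 0; NOT a stub of the
picked line's composition). [folklore] -/
theorem stub_depth3Encoding : ∀ (n : ℕ) (𝒲 : Finset (Finset ((⊤ : SimpleGraph (Fin n)).edgeSet))) (τ : Finset (Fin n) → Prop), (∀ Z, τ Z ↔ ∀ S ∈ 𝒲, ∃ e ∈ S, ∀ v ∈ (e : Sym2 (Fin n)), v ∈ Z) → ∀ (𝓜 : Finset (Finset (Fin n))), (∀ Z, Z ∈ 𝓜 ↔ τ Z ∧ ∀ v ∈ Z, ¬ τ (Z.erase v)) → ∀ (L : ℕ), 1 ≤ L → (∀ S ∈ 𝒲, S.card ≤ L) → ∀ (k z : ℕ), ((kSubsets n k).filter fun A => ∃ Z ∈ 𝓜, Z.card = z ∧ Z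 ⊆ A).card * n ^ z ≤ L ^ z * ((kSubsets n k).card * (min k n) ^ z) :=
  fun _ 𝒲 τ hτ 𝓜 h𝓜 _ hL hW k z => depth3_card_kSubsets_superset_minimal_mul_le 𝒲 τ hτ 𝓜 h𝓜 hL hW k z

end Summit.PneNP.PneNP.Theorems
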